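import Literature.Probability.LatticeModels.KilledWalkGreen
import Literature.Probability.LatticeModels.KilledHarmonicRatio
import Literature.Probability.LatticeModels.WeakBeurlingHoleFree
import Literature.Probability.LatticeModels.KilledGreenLogBounds
import Literature.Probability.LatticeModels.HarmonicFlatBoundaryRow
import HarnessLib

/-!
# Green's function estimates in lattice boxes for the free planar walk
(line `symplectic-fermion-anchor`, crux `SAWLoopFugacityFlow.AvoidanceLimit`,
stmt-CriticalPhenomena-10649; stubs `le_killedRegionGreen_mW`, `killedRegionGreen_mW_le`)

For the simple random walk on `ℤ²` (the edge-killed walk of `KilledWalkGreen.lean` run on the FULL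
nearest-neighbour graph `zdGraph 2`, so that nothing is killed) in the box `mW c k` of sup-radius `48k`
about the pole `c`, the Green function `G(w) = killedRegionGreen (zdGraph 2) (mW c k) w c` satisfies
Chelkak's two disc estimates (Chelkak 2016, Lemma 2.11; Lawler 1991, Prop. 1.6.7 for the disc):

* `le_killedRegionGreen_mW` — `G ≥ c₁ > 0` on the inner box `mB c k` (sup-radius `12k`), uniformly in
  `c` and `k ≥ 1`;
* `killedRegionGreen_mW_le` — `G ≤ C₁` at sup-distance `≥ 12k - 1` from the pole, uniformly.

Route of proof (everything is proved, no named fact is used):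
`G(w) = 2 (h(w) - a(w - c))` on the box (`killedRegionGreen_eq_two_mul_sub`), where `a` is the planar
potential kernel (`Δ a = 2δ₀`, `LatticePotentialKernel.lean`) and `h` the free harmonic extension of
`a(· - c)` from the outer boundary of the box (Green's representation formula
`eq_sum_killedRegionGreen_add_killedHarmExt`); the outer boundary sits at Euclidean distance
`∈ [48k+1, 2(48k+1)]` from `c`, so the quantitative asymptotics
`a(x) = (1/π) log |x| + k₀/2 + O(1/|x|)` (`latticePotentialKernel_two_rate`, through
`KozdronLawler.potentialKernel_mem_of_annulus`) give both bounds with logarithms of bounded ratios.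
For the lower bound the `O(1/|x|)` error is only small far from the pole: for `k` beyond a threshold
we bound `G ≥ 1/4` on the layer `‖w - c‖_∞ = 12k` and propagate inside by the minimum principle
(`G(·,c)` is harmonic off the pole and `G(c,c) ≥ 1`); below the threshold we use the crude bound
`G(w) ≥ 4^{-‖w - c‖₁}` from superharmonicity (`IsKilledSuperharmonicOn.le_four_mul_of_adj`).

Sources: D. Chelkak, Ann. Probab. 44 (2016), Lemma 2.11 [Chelkak2016]; G. F. Lawler,
*Intersections of Random Walks* (1991), Thm. 1.6.6, Prop. 1.6.7 [Lawler1991]. No definitions.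
-/

noncomputable section

open scoped BigOperators Classical
open Finset
open Literature.Probability.LatticeModels
open Literature.Probability.LatticeModels.WeakBeurling (sqBox mem_sqBox sqBox_mono sqBox_finite
  mem_sqBox_succ_of_adj)

namespace Summit.CriticalPhenomena.SAWScalingLimit.Theorems.AvoidanceLimit.Anchor

/-! ### The free walk: Laplacian, constants, harmonic extension -/

/-- For the free walk (`Gr = zdGraph 2`, all four edges kept) the killed average minus the value is
a quarter of the graph Laplacian: `killedAvg f v - f v = ¼ Δ f (v)` (the two planar Laplacians of
the tree agree, `latticeLaplacian_eq_latticeLaplacianZd`). [folklore] -/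
theorem killedAvg_zdGraph_sub (f : Site 2 → ℝ) (v : Site 2) :
    killedAvg (zdGraph 2) f v - f v = 4⁻¹ * latticeLaplacianZd f v := by
  rw [killedAvg_eq_of_forall_adj (zdGraph 2) (fun e => zdGraph_adj_add_stepVec v e),
    ← latticeLaplacian_eq_latticeLaplacianZd, latticeLaplacian_eq]
  ring

/-- Constants are harmonic for the free walk. [folklore] -/
theorem isKilledHarmonicOn_const_zdGraph (m : ℝ) (S : Set (Site 2)) :
    IsKilledHarmonicOn (zdGraph 2) (fun _ => m) S := by
  intro v _
  rw [killedAvg_eq_of_forall_adj (zdGraph 2) (fun e => zdGraph_adj_add_stepVec v e),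
    Fin.sum_univ_four]
  ring

/-- **Lower bound for the free harmonic extension** (no sign condition, since nothing is killed):
data `≥ m` on the outer boundary of the finite set `S` give a solution `≥ m` on `S`. [folklore] -/
theorem le_killedHarmExt_zdGraph {S : Set (Site 2)} (hS : S.Finite) {g : Site 2 → ℝ} {m : ℝ}
    (hg : ∀ w ∈ killedOuterBoundary (zdGraph 2) S, m ≤ g w) :
    ∀ v ∈ S, m ≤ killedHarmExt (zdGraph 2) S g v :=
  le_of_killedSub_killedSuper_of_boundary hS (isKilledHarmonicOn_const_zdGraph m S).subharmonicOn
    (killedHarmExt_harmonicOn hS g).superharmonicOn fun w hw => by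
      rw [killedHarmExt_of_not_mem g hw.1]; exact hg w hw

/-- **Upper bound for the free harmonic extension**: data `≤ M` on the outer boundary of the
finite set `S` give a solution `≤ M` on `S`. [folklore] -/
theorem killedHarmExt_zdGraph_le {S : Set (Site 2)} (hS : S.Finite) {g : Site 2 → ℝ} {M : ℝ}
    (hg : ∀ w ∈ killedOuterBoundary (zdGraph 2) S, g w ≤ M) :
    ∀ v ∈ S, killedHarmExt (zdGraph 2) S g v ≤ M :=
  le_of_killedSub_killedSuper_of_boundary hS (killedHarmExt_harmonicOn hS g).subharmonicOn
    (isKilledHarmonicOn_const_zdGraph M S).superharmonicOn fun w hw => by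
      rw [killedHarmExt_of_not_mem g hw.1]; exact hg w hw

/-! ### The Green function of a finite set through the potential kernel -/

/-- Translating the argument commutes with the graph Laplacian of `ℤ²`. [folklore] -/
theorem latticeLaplacianZd_comp_sub (H : Site 2 → ℝ) (c y : Site 2) :
    latticeLaplacianZd (fun x => H (x - c)) y = latticeLaplacianZd H (y - c) := by
  have h1 : ∀ i : Fin 2, y + Pi.single i (1 : ℤ) - c = y - c + Pi.single i 1 := fun i => by abel
  have h2 : ∀ i : Fin 2, y - Pi.single i (1 : ℤ) - c = y - c - Pi.single i 1 := fun i => by abel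
  simp only [latticeLaplacianZd_def, h1, h2]

/-- **Poisson equation of the shifted potential kernel for the free walk**:
`a(y - c) - killedAvg (a(· - c)) y = -½·[y = c]` (`Δ a = 2δ₀`). [folklore] -/
theorem potentialKernel_sub_killedAvg (c y : Site 2) :
    latticePotentialKernel 2 (y - c) -
        killedAvg (zdGraph 2) (fun x => latticePotentialKernel 2 (x - c)) y =
      -(2⁻¹ * if y = c then 1 else 0) := by
  have h1 := killedAvg_zdGraph_sub (fun x => latticePotentialKernel 2 (x - c)) y
  rw [latticeLaplacianZd_comp_sub, latticeLaplacianZd_latticePotentialKernel 2 (by norm_num) (y - c)]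
    at h1
  simp only [sub_eq_zero] at h1
  split_ifs at h1 ⊢ <;> linarith

/-- **The Green function of the free walk in a finite set through the potential kernel**
(Lawler 1991, Prop. 1.6.3-type identity; Kozdron–Lawler 2005, (15)): for finite `S ∋ c` and
`v ∈ S`, `G_S(v,c) = 2 (h(v) - a(v - c))`, `h` the free harmonic extension to `S` of the boundary
values of `a(· - c)`. [cite: Lawler1991, Prop. 1.6.7] -/
theorem killedRegionGreen_eq_two_mul_sub {S : Set (Site 2)} (hS : S.Finite) {c : Site 2} (hc : c ∈ S)
    {v : Site 2} (hv : v ∈ S) :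
    killedRegionGreen (zdGraph 2) S v c =
      2 * (killedHarmExt (zdGraph 2) S (fun x => latticePotentialKernel 2 (x - c)) v -
        latticePotentialKernel 2 (v - c)) := by
  have key := eq_sum_killedRegionGreen_add_killedHarmExt (Gr := zdGraph 2) hS
    (fun x => latticePotentialKernel 2 (x - c)) v hv
  have h1 : ∀ y ∈ hS.toFinset, killedRegionGreen (zdGraph 2) S v y *
      (latticePotentialKernel 2 (y - c) -
        killedAvg (zdGraph 2) (fun x => latticePotentialKernel 2 (x - c)) y) =
      if c = y then -(2⁻¹ * killedRegionGreen (zdGraph 2) S v c) else 0 := by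
    intro y _
    rw [potentialKernel_sub_killedAvg]
    by_cases h : c = y
    · subst h; rw [if_pos rfl, if_pos rfl]; ring
    · rw [if_neg (Ne.symm h), if_neg h]; ring
  have key' : latticePotentialKernel 2 (v - c) = ∑ y ∈ hS.toFinset, killedRegionGreen (zdGraph 2) S v y *
      (latticePotentialKernel 2 (y - c) -
        killedAvg (zdGraph 2) (fun x => latticePotentialKernel 2 (x - c)) y) +
      killedHarmExt (zdGraph 2) S (fun x => latticePotentialKernel 2 (x - c)) v := key
  rw [Finset.sum_congr rfl h1, Finset.sum_ite_eq, if_pos (hS.mem_toFinset.2 hc)] at key'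
  linarith

/-! ### Box geometry -/

/-- The outer boundary of the box `sqBox c n` for the free walk lies in the next layer. [folklore] -/
theorem mem_layer_of_mem_killedOuterBoundary_sqBox {c w : Site 2} {n : ℤ}
    (hw : w ∈ killedOuterBoundary (zdGraph 2) (sqBox c n)) : w ∈ sqBox c (n + 1) ∧ w ∉ sqBox c n := by
  obtain ⟨hwS, v, hv, e, rfl, hadj⟩ := hw
  exact ⟨mem_sqBox_succ_of_adj hv hadj, hwS⟩

/-- Off the box of sup-radius `n` about `c`, the Euclidean distance to `c` is at least `n + 1`. [folklore] -/
theorem le_norm_toComplex_of_not_mem_sqBox {c w : Site 2} {n : ℤ} (hw : w ∉ sqBox c n) :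
    (n : ℝ) + 1 ≤ ‖Site.toComplex (w - c)‖ := by
  rw [mem_sqBox, not_and_or, not_le, not_le] at hw
  have hre := Complex.abs_re_le_norm (Site.toComplex (w - c))
  have him := Complex.abs_im_le_norm (Site.toComplex (w - c))
  simp only [Site.toComplex_re, Site.toComplex_im, Pi.sub_apply, Int.cast_sub] at hre him
  rcases hw with h | h
  · have h' : n + 1 ≤ |w 0 - c 0| := h
    have h'' : (n : ℝ) + 1 ≤ |((w 0 : ℤ) : ℝ) - ((c 0 : ℤ) : ℝ)| := by
      rw [← Int.cast_sub, ← Int.cast_abs]; exact_mod_cast h'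
    linarith
  · have h' : n + 1 ≤ |w 1 - c 1| := h
    have h'' : (n : ℝ) + 1 ≤ |((w 1 : ℤ) : ℝ) - ((c 1 : ℤ) : ℝ)| := by
      rw [← Int.cast_sub, ← Int.cast_abs]; exact_mod_cast h'
    linarith

/-- On the box of sup-radius `n` about `c`, the Euclidean distance to `c` is at most `2n`. [folklore] -/
theorem norm_toComplex_le_of_mem_sqBox {c w : Site 2} {n : ℤ} (hw : w ∈ sqBox c n) :
    ‖Site.toComplex (w - c)‖ ≤ 2 * n := by
  rw [mem_sqBox] at hw
  have h := Complex.norm_le_abs_re_add_abs_im (Site.toComplex (w - c))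
  simp only [Site.toComplex_re, Site.toComplex_im, Pi.sub_apply, Int.cast_sub] at h
  have h0 : |((w 0 : ℤ) : ℝ) - ((c 0 : ℤ) : ℝ)| ≤ n := by
    rw [← Int.cast_sub, ← Int.cast_abs]; exact_mod_cast hw.1
  have h1 : |((w 1 : ℤ) : ℝ) - ((c 1 : ℤ) : ℝ)| ≤ n := by
    rw [← Int.cast_sub, ← Int.cast_abs]; exact_mod_cast hw.2
  linarith

/-- The centre lies in its box `mW c k`. [folklore] -/
theorem centre_mem_mW (c : Site 2) (k : ℕ) : c ∈ mW c k := by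
  show |c 0 - c 0| ≤ 48 * (k : ℤ) ∧ |c 1 - c 1| ≤ 48 * (k : ℤ)
  simp only [sub_self, abs_zero]
  constructor <;> positivity

/-! ### The upper bound off the inner box (Chelkak 2016, Lemma 2.11, second half) -/

/-- **Green's function of the free walk in a box is bounded off the inner box** (Chelkak 2016,
Lemma 2.11, `G_{B_Γ(r)}(v;u) ≤ ϖ₀` off the inner disc; Lawler 1991, Prop. 1.6.7): there is a universal
`C₁` with `killedRegionGreen (zdGraph 2) (mW c k) w c ≤ C₁` for every centre `c`, every `k ≥ 1` and
every `w` at sup-distance `≥ 12k - 1` from `c`. [cite: Chelkak2016, Lemma 2.11] -/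
theorem killedRegionGreen_mW_le :
    ∃ C₁ : ℝ, ∀ (c : Site 2) (k : ℕ), 0 < k →
      ∀ w : Site 2, w ∉ WeakBeurling.sqBox c (12 * k - 2) →
        killedRegionGreen (zdGraph 2) (mW c k) w c ≤ C₁ := by
  obtain ⟨C₀, hC₀⟩ := latticePotentialKernel_two_rate
  have hlog9 : 0 ≤ Real.log 9 := Real.log_nonneg (by norm_num)
  refine ⟨2 / Real.pi * Real.log 9 + 2 * |C₀|, fun c k hk w hw => ?_⟩
  by_cases hwW : w ∈ mW c k
  swap
  · rw [killedRegionGreen_of_not_mem_left _ hwW]; positivity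
  have hW := mW_finite c k
  have hk1 : (1 : ℝ) ≤ k := by exact_mod_cast hk
  rw [killedRegionGreen_eq_two_mul_sub hW (centre_mem_mW c k) hwW]
  -- the harmonic extension is at most the maximum of `a(· - c)` over the outer layer
  have hHE : killedHarmExt (zdGraph 2) (mW c k) (fun x => latticePotentialKernel 2 (x - c)) w ≤
      1 / Real.pi * Real.log (2 * (48 * k + 1)) + KozdronLawler.greenConst / 2 +
        |C₀| / (48 * k + 1) := by
    refine killedHarmExt_zdGraph_le hW (fun z hz => ?_) w hwW
    rw [mW_eq_sqBox] at hz
    obtain ⟨hz1, hz2⟩ := mem_layer_of_mem_killedOuterBoundary_sqBox hz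
    have hr : (48 * k + 1 : ℝ) ≤ ‖Site.toComplex (z - c)‖ := by
      have := le_norm_toComplex_of_not_mem_sqBox hz2; push_cast at this; linarith
    have hR : ‖Site.toComplex (z - c)‖ ≤ 2 * (48 * k + 1) := by
      have := norm_toComplex_le_of_mem_sqBox hz1; push_cast at this; linarith
    exact (KozdronLawler.potentialKernel_mem_of_annulus (by linarith) hC₀ hr hR).2
  -- the pole term is at least `(1/π) log (12k - 1) + k₀/2 - |C₀|/(12k - 1)`
  have hρ : (12 * k - 1 : ℝ) ≤ ‖Site.toComplex (w - c)‖ := by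
    have := le_norm_toComplex_of_not_mem_sqBox hw; push_cast at this; linarith
  have haw := (KozdronLawler.potentialKernel_mem_of_annulus (r := 12 * k - 1) (by linarith) hC₀
    hρ le_rfl).1
  have hlog : Real.log (2 * (48 * k + 1)) ≤ Real.log 9 + Real.log (12 * k - 1) := by
    rw [← Real.log_mul (by norm_num) (by linarith)]
    exact Real.log_le_log (by positivity) (by linarith)
  have hπ : (0 : ℝ) ≤ 1 / Real.pi := by positivity
  have hlog' : 1 / Real.pi * Real.log (2 * (48 * k + 1)) ≤
      1 / Real.pi * Real.log 9 + 1 / Real.pi * Real.log (12 * k - 1) := by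
    rw [← mul_add]; exact mul_le_mul_of_nonneg_left hlog hπ
  have he1 : |C₀| / (48 * k + 1) ≤ |C₀| / 2 :=
    div_le_div_of_nonneg_left (abs_nonneg _) (by norm_num) (by linarith)
  have he2 : |C₀| / (12 * k - 1) ≤ |C₀| / 2 :=
    div_le_div_of_nonneg_left (abs_nonneg _) (by norm_num) (by linarith)
  have h2π : 2 / Real.pi * Real.log 9 = 2 * (1 / Real.pi * Real.log 9) := by ring
  linarith

/-! ### The lower bound on the inner box (Chelkak 2016, Lemma 2.11, first half) -/

/-- One lattice step changes `G_S(·,c)` by a factor at most four (superharmonicity of the Green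
function for the free walk). [folklore] -/
theorem killedRegionGreen_le_four_mul_of_adj {S : Set (Site 2)} (hS : S.Finite) (c : Site 2)
    {v w : Site 2} (hv : v ∈ S) (hadj : (zdGraph 2).Adj v w) :
    killedRegionGreen (zdGraph 2) S w c ≤ 4 * killedRegionGreen (zdGraph 2) S v c := by
  obtain ⟨e, rfl⟩ := SRW.exists_dir_of_adj hadj
  exact (killedRegionGreen_superharmonicOn hS c).le_four_mul_of_adj
    (fun x => killedRegionGreen_nonneg S x c) hv (zdGraph_adj_add_stepVec v e)

/-- **Crude lower bound along monotone lattice paths**: on `mB c k`,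
`(1/4)^n ≤ G_{mW}(w,c)` whenever `‖w - c‖₁ ≤ n` (`G(c,c) ≥ 1` and one factor `4` per step). [folklore] -/
theorem pow_le_killedRegionGreen_mW (c : Site 2) (k : ℕ) :
    ∀ (n : ℕ) (w : Site 2), w ∈ mB c k → (w 0 - c 0).natAbs + (w 1 - c 1).natAbs ≤ n →
      (1 / 4 : ℝ) ^ n ≤ killedRegionGreen (zdGraph 2) (mW c k) w c := by
  have hW := mW_finite c k
  intro n
  induction n with
  | zero =>
    intro w hw hn
    have hwc : w = c := by
      ext i; fin_cases i <;> simp <;> omega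
    rw [hwc, pow_zero]
    exact one_le_killedRegionGreen_diag hW (centre_mem_mW c k)
  | succ n ih =>
    intro w hw hn
    by_cases hle : (w 0 - c 0).natAbs + (w 1 - c 1).natAbs ≤ n
    · exact (pow_le_pow_of_le_one (by norm_num) (by norm_num) (Nat.le_succ n)).trans (ih w hw hle)
    -- a neighbour `w'` of `w` in `mB c k`, one step closer to `c`
    obtain ⟨w', hw'B, hw'n, hadj⟩ : ∃ w' : Site 2, w' ∈ mB c k ∧
        (w' 0 - c 0).natAbs + (w' 1 - c 1).natAbs ≤ n ∧ (zdGraph 2).Adj w w' := by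
      simp only [mB, Set.mem_setOf_eq, abs_le] at hw ⊢
      by_cases h0 : w 0 < c 0
      · refine ⟨w + Pi.single 0 1, ?_, ?_, (zdGraph_adj_iff _ _).2 ⟨0, Or.inl rfl⟩⟩ <;>
          simp <;> omega
      by_cases h0' : c 0 < w 0
      · refine ⟨w - Pi.single 0 1, ?_, ?_, (zdGraph_adj_iff _ _).2 ⟨0, Or.inr (by simp)⟩⟩ <;>
          simp <;> omega
      by_cases h1 : w 1 < c 1
      · refine ⟨w + Pi.single 1 1, ?_, ?_, (zdGraph_adj_iff _ _).2 ⟨1, Or.inl rfl⟩⟩ <;>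
          simp <;> omega
      refine ⟨w - Pi.single 1 1, ?_, ?_, (zdGraph_adj_iff _ _).2 ⟨1, Or.inr (by simp)⟩⟩ <;>
        simp <;> omega
    have h4 := killedRegionGreen_le_four_mul_of_adj hW c (mB_subset_mW hw) hadj
    have := ih w' hw'B hw'n
    rw [pow_succ]
    nlinarith

/-- **The layer bound**: there is a threshold `K₀` such that for `k ≥ K₀`, on the layer
`‖w - c‖_∞ = 12k` of the box `mW c k`, `G_{mW}(w,c) ≥ 1/4`
(`(2/π) log 2 - O(1/k) ≥ 1/4`). [cite: Lawler1991, Prop. 1.6.7] -/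
theorem quarter_le_killedRegionGreen_layer : ∃ K₀ : ℕ, ∀ (c : Site 2) (k : ℕ), K₀ ≤ k →
    ∀ w ∈ sqBox c (12 * k), w ∉ sqBox c (12 * k - 1) →
      (1 / 4 : ℝ) ≤ killedRegionGreen (zdGraph 2) (mW c k) w c := by
  obtain ⟨C₀, hC₀⟩ := latticePotentialKernel_two_rate
  refine ⟨10 * ⌈|C₀|⌉₊ + 1, fun c k hk w hw hw' => ?_⟩
  have hkpos : 0 < k := by omega
  have hk1 : (1 : ℝ) ≤ k := by exact_mod_cast hkpos
  have hkC : 10 * |C₀| + 1 ≤ (k : ℝ) := by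
    have h1 : |C₀| ≤ (⌈|C₀|⌉₊ : ℝ) := Nat.le_ceil _
    have h2 : ((10 * ⌈|C₀|⌉₊ + 1 : ℕ) : ℝ) ≤ k := by exact_mod_cast hk
    push_cast at h2
    linarith
  have hW := mW_finite c k
  have hwW : w ∈ mW c k := by
    rw [mW_eq_sqBox]; exact sqBox_mono c (by omega) hw
  rw [killedRegionGreen_eq_two_mul_sub hW (centre_mem_mW c k) hwW]
  -- the harmonic extension is at least the minimum of `a(· - c)` over the outer layer
  have hHE : 1 / Real.pi * Real.log (48 * k + 1) + KozdronLawler.greenConst / 2 - |C₀| / (48 * k + 1) ≤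
      killedHarmExt (zdGraph 2) (mW c k) (fun x => latticePotentialKernel 2 (x - c)) w := by
    refine le_killedHarmExt_zdGraph hW (fun z hz => ?_) w hwW
    rw [mW_eq_sqBox] at hz
    obtain ⟨hz1, hz2⟩ := mem_layer_of_mem_killedOuterBoundary_sqBox hz
    have hr : (48 * k + 1 : ℝ) ≤ ‖Site.toComplex (z - c)‖ := by
      have := le_norm_toComplex_of_not_mem_sqBox hz2; push_cast at this; linarith
    have hR : ‖Site.toComplex (z - c)‖ ≤ 2 * (48 * k + 1) := by
      have := norm_toComplex_le_of_mem_sqBox hz1; push_cast at this; linarith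
    exact (KozdronLawler.potentialKernel_mem_of_annulus (by linarith) hC₀ hr hR).1
  -- the pole term on the layer: `12k ≤ |w - c| ≤ 24k`
  have hρ1 : (12 * k : ℝ) ≤ ‖Site.toComplex (w - c)‖ := by
    have := le_norm_toComplex_of_not_mem_sqBox hw'; push_cast at this; linarith
  have hρ2 : ‖Site.toComplex (w - c)‖ ≤ 24 * k := by
    have := norm_toComplex_le_of_mem_sqBox hw; push_cast at this; linarith
  have haw := (KozdronLawler.potentialKernel_mem_of_annulus (r := 12 * k) (by linarith) hC₀ hρ1 hρ2).2
  -- logarithms and error terms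
  have hlog : Real.log 2 + Real.log (24 * k) ≤ Real.log (48 * k + 1) := by
    rw [← Real.log_mul (by norm_num) (by positivity)]
    exact Real.log_le_log (by positivity) (by linarith)
  have hπ : (0 : ℝ) ≤ 1 / Real.pi := by positivity
  have hlog' : 1 / Real.pi * Real.log 2 + 1 / Real.pi * Real.log (24 * k) ≤
      1 / Real.pi * Real.log (48 * k + 1) := by
    rw [← mul_add]; exact mul_le_mul_of_nonneg_left hlog hπ
  have he1 : |C₀| / (48 * k + 1) ≤ 1 / 120 := by
    rw [div_le_div_iff₀ (by positivity) (by norm_num)]; nlinarith [abs_nonneg C₀]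
  have he2 : |C₀| / (12 * k) ≤ 1 / 120 := by
    rw [div_le_div_iff₀ (by positivity) (by norm_num)]; nlinarith [abs_nonneg C₀]
  have hmain : (1 / 4 + 1 / 30 : ℝ) ≤ 2 * (1 / Real.pi * Real.log 2) := by
    have h1 : 1 / 4 * Real.log 2 ≤ 1 / Real.pi * Real.log 2 :=
      mul_le_mul_of_nonneg_right (one_div_le_one_div_of_le Real.pi_pos Real.pi_le_four)
        (Real.log_nonneg one_le_two)
    linarith [Real.log_two_gt_d9]
  linarith

/-- **`G ≥ 1/4` on the whole inner box beyond the threshold**: the minimum principle for `G(·,c)`,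
harmonic on `sqBox c (12k - 1) ∖ {c}`, with `G ≥ 1/4` on the layer and `G(c,c) ≥ 1`. [folklore] -/
theorem quarter_le_killedRegionGreen_mB : ∃ K₀ : ℕ, ∀ (c : Site 2) (k : ℕ), K₀ ≤ k →
    ∀ w ∈ mB c k, (1 / 4 : ℝ) ≤ killedRegionGreen (zdGraph 2) (mW c k) w c := by
  obtain ⟨K₀, hK₀⟩ := quarter_le_killedRegionGreen_layer
  refine ⟨K₀ + 1, fun c k hk w hw => ?_⟩
  have hkpos : 0 < k := by omega
  have hW := mW_finite c k
  have hlayer := hK₀ c k (by omega)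
  set G : Site 2 → ℝ := fun x => killedRegionGreen (zdGraph 2) (mW c k) x c with hG
  have hcc : (1 / 4 : ℝ) ≤ G c :=
    le_trans (by norm_num) (one_le_killedRegionGreen_diag hW (centre_mem_mW c k))
  -- the punctured inner box
  set T : Set (Site 2) := sqBox c (12 * k - 1) \ {c} with hT
  have hTfin : T.Finite := (sqBox_finite c (12 * k - 1)).subset fun x hx => hx.1
  have hTsub : T ⊆ mW c k \ {c} := by
    rw [mW_eq_sqBox]
    exact fun x hx => ⟨sqBox_mono c (by omega) hx.1, hx.2⟩
  have hharm : IsKilledHarmonicOn (zdGraph 2) G T := (killedRegionGreen_harmonicOn hW c).mono hTsub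
  have hbd : ∀ z ∈ killedOuterBoundary (zdGraph 2) T, (fun _ => (1 / 4 : ℝ)) z ≤ G z := by
    rintro z ⟨hzT, v, hv, e, rfl, hadj⟩
    have hz : v + SRW.stepVec e ∈ sqBox c (12 * k) := by
      have := mem_sqBox_succ_of_adj hv.1 hadj
      rwa [sub_add_cancel] at this
    by_cases hzc : v + SRW.stepVec e = c
    · rw [hzc]; exact hcc
    · have hz' : v + SRW.stepVec e ∉ sqBox c (12 * k - 1) := fun h => hzT ⟨h, hzc⟩
      exact hlayer _ hz hz'
  have hin := le_of_killedSub_killedSuper_of_boundary hTfin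
    (isKilledHarmonicOn_const_zdGraph (1 / 4) T).subharmonicOn hharm.superharmonicOn hbd
  -- assemble
  by_cases hwc : w = c
  · rw [hwc]; exact hcc
  by_cases hwin : w ∈ sqBox c (12 * k - 1)
  · exact hin w ⟨hwin, hwc⟩
  · exact hlayer w hw hwin

/-- **Green's function of the free walk in a box is bounded below on the inner box** (Chelkak 2016,
Lemma 2.11, `G_{B_Γ(r)}(v;u) ≥ ϖ₀` on the inner disc; Lawler 1991, Prop. 1.6.7): there is a universal
`c₁ > 0` with `c₁ ≤ killedRegionGreen (zdGraph 2) (mW c k) w c` for every centre `c`, every `k ≥ 1`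
and every `w ∈ mB c k`. [cite: Chelkak2016, Lemma 2.11] -/
theorem le_killedRegionGreen_mW :
    ∃ c₁ : ℝ, 0 < c₁ ∧ ∀ (c : Site 2) (k : ℕ), 0 < k →
      ∀ w ∈ mB c k, c₁ ≤ killedRegionGreen (zdGraph 2) (mW c k) w c := by
  obtain ⟨K₀, hK₀⟩ := quarter_le_killedRegionGreen_mB
  refine ⟨(1 / 4) ^ (24 * K₀ + 1), by positivity, fun c k hk w hw => ?_⟩
  by_cases hkK : K₀ ≤ k
  · calc ((1 : ℝ) / 4) ^ (24 * K₀ + 1) ≤ (1 / 4) ^ 1 :=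
          pow_le_pow_of_le_one (by norm_num) (by norm_num) (by omega)
      _ ≤ killedRegionGreen (zdGraph 2) (mW c k) w c := by
          rw [pow_one]; exact hK₀ c k hkK w hw
  · refine pow_le_killedRegionGreen_mW c k _ w hw ?_
    have hw' := hw
    simp only [mB, Set.mem_setOf_eq, abs_le] at hw'
    omega

end Summit.CriticalPhenomena.SAWScalingLimit.Theorems.AvoidanceLimit.Anchor

end
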